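import Summits.Parity.GeneralizedHardyLittlewood.Theorems.GoldbachHeathBrownDispersionHeathBrownMorozUniform
import Summits.Parity.GeneralizedHardyLittlewood.Theorems.GoldbachHeathBrownDispersionAssembly
import Summits.Parity.GeneralizedHardyLittlewood.Theorems.GoldbachHeathBrownDispersionClassTransfer
import Summits.Parity.GeneralizedHardyLittlewood.Theorems.GoldbachHeathBrownDispersionModelDispersion
import Summits.Parity.GeneralizedHardyLittlewood.Theorems.GoldbachHeathBrownDispersionModelMainTerm
import Summits.Parity.GeneralizedHardyLittlewood.Theorems.GoldbachHeathBrownDispersionFourierSideComparison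
import HarnessLib

/-!
# Target `GoldbachHeathBrownAlmostAll` (stmt-Parity-19908) of route `GoldbachHeathBrownDispersion` — PROVED

Almost all even `n ∈ (N, 2N]` are `p + π` with `p` prime and `π = x³ + 2y³` a Heath-Brown prime (the route's
leaf, rung F-P1b of the Parity FRONTIER ladder): the route's Assembly (`goldbachHeathBrownDispersion_assembly_proof`,
second moment / Chebyshev over the minor-arc dispersion of the rough model) applied to its five inputs, all
kernel theorems — `HeathBrownMorozUniform` (this session), `ClassTransfer`, `ModelDispersion`, `ModelMainTerm`,
`FourierSideComparison`. Goldbach's conjecture itself is NOT proved by this (almost-all, one summand from a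
thin set).

## References

* D. R. Heath-Brown, B. Z. Moroz, Proc. London Math. Soc. 88 (2004), Theorem 2. [cite: HeathBrownMoroz2004, Theorem 2]
* H. L. Montgomery, R. C. Vaughan, Acta Arith. 27 (1975). [cite: MontgomeryVaughan1975, Theorem]
-/

noncomputable section

namespace Summit.Parity.GeneralizedHardyLittlewood.Theorems

/-- **`GoldbachHeathBrownAlmostAll` (stmt-Parity-19908) holds**: the Assembly applied to the five proved route
items. Goldbach is not proved by this. [cite: HeathBrownMoroz2004, Theorem 2] -/
theorem goldbachHeathBrownDispersion_goldbachHeathBrownAlmostAll_proof :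
    Summit.Parity.GeneralizedHardyLittlewood.Theses.GoldbachHeathBrownDispersion.GoldbachHeathBrownAlmostAll :=
  goldbachHeathBrownDispersion_assembly_proof goldbachHeathBrownDispersion_heathBrownMorozUniform_proof
    goldbachHeathBrownDispersion_classTransfer_proof goldbachHeathBrownDispersion_modelDispersion_proof
    goldbachHeathBrownDispersion_modelMainTerm_proof goldbachHeathBrownDispersion_fourierSideComparison_proof

end Summit.Parity.GeneralizedHardyLittlewood.Theorems

end
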